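import Mathlib
import Literature.MathematicalPhysics.QuantumFieldTheory.Balaban1983to89.B6LevelGapMetric
import Literature.MathematicalPhysics.QuantumFieldTheory.Balaban1983to89.B6LevelTower

/-!
# `Balaban1983to89.B6Decomp247Surfaces` — [Balaban1984PropagatorsII] Sect. A pp. 231–232: the surfaces Σ_j, the
# DECOMPOSITION (2.47) of an admissible contour at the surfaces and BOTH LINES of the lower bound (2.48) for the
# multiscale distance d(y, y′) of (2.46), KERNEL-DERIVED at the typed generality of (2.46) in the tree (zoned graph of
# admissible bonds, `B6Geometry`; drawing with Λ_j-bond lengths, `B6LevelGapMetric`), and instantiated on the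
# (k+1)-level tower of `B6LevelTower`

statement-level skeleton of published theorems with citation tags; proofs where landed; nothing here is a claim about the Yang–Mills mass gap

CITATION HEADER (lean-in-tree rule 2026-08-18).  Source: T. Bałaban, *Propagators and renormalization transformations for
lattice gauge theories. II*, Commun. Math. Phys. **96**, 223–250 (1984), doi:10.1007/bf01240221 [Balaban1984PropagatorsII]
(cell paper B6; held `paper:balaban1984-cmp96-propagators-rt-ii`, journal page = PDF page + 222; pp. 231–232 [PDF 9–10]
read AS IMAGES on the ×2 renders `run/shared/lean/pub/pub-balaban/b2b-balaban-ref1/pages/1984-cmp96-propagators-rt-II/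
1984-cmp96-propagators-rt-II-p009-x2.png`, `…-p010-x2.png`, 2026-08-21).  lit-balaban SKELETON row **B6.Eq2.47** ((2.47)–(2.48)
pp. 231–232; owner r03, referee ref-4); Phase-2 file of unit `lit-balaban-r03` (gen 7), HOME `run/shared/lean/pub/lit-balaban/`.
IMPORTS, NOT MODIFIED: `…B6Geometry` (pv08 g2: `Separates`, `ContourSystem`, `dist246`, `Realizes` — the typed (2.46)),
`…B6LevelGapMetric` (pv08: `BondScale`, `BondScale22` — the metric form of p. 231 *"|Γ| = nη"* ∕ Λ_j-bonds),
`…B6LevelTower` (b06 g20: the coordinatised (k+1)-level tower `twGeo`/`twCS`, `twCS_separates`, `twCS_bondScale22`,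
`twCS_connected`, `twGeo_realizes`).  RELATED, NOT USED: `…B6Lemma21Bridge.Decomp247` (b06: the SHRUNKEN decomposition data —
episode count, wall indices, leg codes, (2.48)/(2.57) as count inequalities, reconstruction — a hypothesis structure feeding
(2.58) ⇒ (2.61″)) and `…B6TowerDecomp` (b06 g24: that structure CONSTRUCTED on the tower).  The present file proves the
decomposition and (2.48) IN THEIR PRINTED SHAPE (points y_l, y′_l on surfaces, portions, the two displayed inequalities with
portion lengths and end-point distances), for EVERY admissible contour, over the abstract dictionary; nothing is restated.

THE PRINTED TEXT (verbatim).  p. 231 [9]: *"For an arbitrary contour Γ on the lattice T_η we put |Γ| = nη, where n is a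
number of bonds the contour Γ consists of. We will define a new distance between two points of 𝔅. We consider a special
class of contours Γ. They have the property that a part of Γ contained in B^j(Λ_j) consists of bonds of the lattice Λ_j.
Now we define d(y, y′) = inf_{Γ_{y,y′}} Σ_{j=0}^k (L^jη)^{−1}|Γ_{y,y′} ∩ B^j(Λ_j)|, y, y′ ∈ 𝔅, (2.46) where the infimum is
taken over all admissible contours described above, with end-points, y, y′. … The domain Ω_j is a sum of cubes of the size
ML^jη. A sum of faces of these cubes which are not contained in the interior of Ω_j forms a surface. We denote this surface by
Σ_j and we use the same notation for the set T^{(j)} ∩ Σ_j = Λ_j ∩ Σ_j. The surface Σ_j separates the sets B^j(Λ_j) and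
B^{j−1}(Λ_{j−1}). Now let us consider the definition (2.46). Of course the infimum is attained at some contour Γ_{y,y′}. Let
us assume that y ∈ Λ_j, y′ ∈ Λ_{j′}. We will analyze a structure of the contour Γ_{y,y′} and we will obtain a bound for the
distance d(y, y′). The contour Γ_{y,y′} starts at y and intersects either the surface Σ_j, or the surface Σ_{j+1}, the first
time at a point y₁. Let us denote the index of the surface by j₁, so y₁ ∈ Σ_{j₁}. A next portion of the contour Γ_{y₁,y′}
starting at y₁ is contained in one of the domains B^{j₁}(Λ_{j₁}), B^{j₁−1}(Λ_{j₁−1}), and intersects one of the surfaces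
Σ_{j₁−1}, Σ_{j₁}, Σ_{j₁+1} the first time at a point y′₁. If this point belongs to Σ_{j₁}, then we consider a next portion of
the contour in the same way and we denote by y′₁ the last intersection point of the contour Γ_{y₁,y′} with the surface
Σ_{j₁}. More exactly it is such a point of the contour Γ_{y₁,y′} that y′₁ ∈ Σ_{j₁}, the portion Γ_{y₁,y′₁} of the contour
does not intersect any surface Σ_j with j ≠ j₁, and it is the last point of the contour with this property. If the point
belongs to one of the surfaces Σ_{j₁−1}, Σ_{j₁+1}, then we denote it by y₂ and we denote the index of the surface by j₂. For
uniformity we take y′₁ = y₁ in this case and we define Γ_{y₁,y′₁} as consisting of one point. Thus the portion Γ_{y′₁,y₂}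
of the contour Γ_{y₁,y′} connects the surface Σ_{j₁} with the surface Σ_{j₂} and is contained in B^{j₁₂}(Λ_{j₁₂}), j₁₂ =
min{j₁, j₂}, moreover |j₁ − j₂| = 1. Now we consider the contour Γ_{y₂,y′} and we apply the same analysis. Continuing this
way we obtain a sequence of points y, y₁, y′₁, y₂, y′₂, …, y_m, y′_m, y′ on Γ_{y,y′}, and a sequence of indices j, j₁, j₂,
…, j_m, j′ with the following properties: Γ_{y,y′} = Γ_{y,y₁} ∪ ⋃_{l=1}^m (Γ_{y_l,y′_l} ∪ Γ_{y′_l,y_{l+1}}), y_{m+1} = y′,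
(2.47) y_l, y′_l ∈ Σ_{j_l}, Γ_{y_l,y′_l} does not intersect any other surface Σ_j, j ≠ j_l, Γ_{y′_l,y_{l+1}} connects the
surface Σ_{j_l} with the surface Σ_{j_{l+1}} and is contained in B^{j_{l,l+1}}(Λ_{j_{l,l+1}}), where j_{l,l+1} =
min{j_l, j_{l+1}}, |j_l − j_{l+1}| = 1."*  p. 232 [10]: *"From this decomposition and the definition (2.46) we get
d(y, y′) ≥ (L^jη)^{−1}|Γ_{y,y₁}| + Σ_{l=1}^m (L^{j_l}η)^{−1}|Γ_{y_l,y′_l}| + Σ_{l=1}^m (L^{j_{l,l+1}}η)^{−1}|Γ_{y′_l,y_{l+1}}|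
≥ (L^jη)^{−1}|y − y₁| + Σ_{l=1}^m (L^{j_l}η)^{−1}|y_l − y′_l| + Σ_{l=1}^m (L^{j_{l,l+1}}η)^{−1}|y′_l − y_{l+1}|. (2.48)"*.

THE DICTIONARY (that of the imported siblings, `B6Geometry` module docstring ∕ D-pv08g2.1, and ONE new entry).  Lattice
points `V`, admissible bonds `G : SimpleGraph V`, `zone x = j` ⟺ x ∈ B^j(Λ_j) (closed-Ω convention), (2.46) = the least
NUMBER of admissible bonds of a contour (each Λ_j-bond contributes (L^jη)^{−1}·L^jη = 1) = `SimpleGraph.dist`, `Separates` =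
p. 231 *"The surface Σ_j separates the sets B^j(Λ_j) and B^{j−1}(Λ_{j−1})"* (zones of the end-points of an admissible bond
differ by at most one), drawing `pos : V → X` into a (pseudo)metric space with `BondScale G zone pos ℓ` = p. 231
*"|Γ| = nη … a part of Γ contained in B^j(Λ_j) consists of bonds of the lattice Λ_j"* (an admissible bond with end-point
zones j, j′ is a Λ_{min{j,j′}}-bond, of length ≤ ℓ (min{j, j′}), ℓ j = L^jη).  NEW ENTRY (§1): **Λ_j ∩ Σ_j** ↦ `OnSurf G zone j x`
:= zone x = j ∧ x has an admissible bond to a point of zone j − 1 — a Λ_{j−1}-bond from B^{j−1}(Λ_{j−1}) = Ω_{j−1} ∖ Ω_j into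
Ω_j ∋ x meets ∂Ω_j = Σ_j, and since the faces of the ML^jη-cubes lie on hyperplanes of the Λ_{j−1}-grid it meets it at its
end-point x only, so x ∈ Σ_j; see TYPING (a) for the converse.  |Γ_portion| ↦ `len pos p s t` = the sum of the drawn lengths of
its bonds; |y − y′| ↦ `dist (pos y) (pos y′)`.  A contour Γ_{y,y′} ↦ a walk `p : G.Walk y y′` with points `p.getVert i`,
i = 0, …, |Γ|_bonds = `p.length`; its portions ↦ index intervals.

WHAT IS PROVED (kernel-checked; no `sorry`; axioms ⊆ {propext, Classical.choice, Quot.sound}; 0 new `def … : Prop` facts).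
§1 `OnSurf`/`OnSomeSurf` and the two ZONE RULES under `Separates`: along an admissible bond the zone cannot rise onto a
surface-free point nor drop from one (`zone_le_of_adj_of_not_onSomeSurf(_left)`, `zone_eq_of_adj_of_not_onSomeSurf`).
§2 For every walk `p` the printed construction, literally: `aIdx 1` = the first surface point y₁ (first-hitting index `nxt`),
`aIdx (l+2)` = the first point after y_{l+1} on a surface OTHER than Σ_{j_{l+1}} (= y_{l+2}), `js l` = j_l = zone y_l
(j₀ = j, `js_zero`; j_{m+1} = j′, `js_m_succ`), `m` = the number of episodes on the contour (`Nat.find`), `bIdx l` = y′_l =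
the LAST point on Σ_{j_l} before another surface (`sSup`; b₀ = 0), `eIdx l` = min{aIdx l, |Γ|} (e_l = index of y_l for l ≤ m,
e_{m+1} = |Γ|: y_{m+1} = y′).  §3 THE PROPERTIES OF (2.47): y_l, y′_l ∈ Σ_{j_l} (`onSurf_aIdx`, `onSurf_bIdx`); Γ_{y_l,y′_l}
meets no other surface (`zone_eq_js_of_surfAt_S`, `not_onSurf_S`); the interior of Γ_{y′_l,y_{l+1}} and the portion before
y₁ and after y′_m meet no surface (`not_surfAt_X`, `not_surfAt_of_lt_aIdx_one`, `not_surfAt_tail`); the SURFACE-FREE STRETCH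
LEMMA (`stretch`); hence **every bond of Γ_{y′_l,y_{l+1}} is a Λ_{min{j_l,j_{l+1}}}-bond** and |j_l − j_{l+1}| ≤ 1 for
l = 0, …, m (`X_facts`), **|j_l − j_{l+1}| = 1** for 1 ≤ l < m (`js_step`, with `js_succ_ne`), **j₁ ∈ {j, j+1}**
(`js_one_bounds`), j_m ∈ {j′, j′+1} (`js_m_bounds`), and **Γ_{y_l,y′_l} ⊂ B^{j_l}(Λ_{j_l}) ∪ B^{j_l−1}(Λ_{j_l−1})** (`S_zone`,
`S_bond_le`); all assembled as `decomp247`.  §4 (2.48): `dist_le_len` (|Γ_portion| ≥ distance of its end-points),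
`inv_mul_len_le` (a portion of Λ_{≤q}-bonds has ≥ (L^qη)^{−1}|portion| bonds), **`ineq248_line1`**: |Γ|_bonds ≥ (L^jη)^{−1}
|Γ_{y,y₁}| + Σ_{l=1}^m (L^{j_l}η)^{−1}|Γ_{y_l,y′_l}| + Σ_{l=1}^m (L^{j_{l,l+1}}η)^{−1}|Γ_{y′_l,y_{l+1}}| for EVERY admissible
contour (telescoping over the index chain 0 = b₀ ≤ e₁ ≤ b₁ < e₂ ≤ … ≤ b_m ≤ e_{m+1} = |Γ|), **`ineq248_line2`**: that sum ≥
the printed sum of end-point distances; packaged `rhs248Len`/`rhs248Pts`, `ineq248_walk`; **`ineq248_dist`**: for the graph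
distance (a shortest contour exists, `Reachable.exists_walk_length_eq_dist` — *"Of course the infimum is attained"*) d(y, y′)
≥ (2.48)₁ ≥ (2.48)₂.  §5 `ineq248_of_realizes`: the same over a `ContourSystem g` with `Realizes g C` (g.dist IS (2.46)),
`Connected`, `Separates`, `BondScale22` (ℓ j = g.L^j·g.eta), g.L ≥ 1, g.eta > 0, j = g.scale y.  §6 `ineq248_tower`: on the
(k+1)-level tower `twGeo d k a m L η R` ∕ `twCS` of `B6LevelTower` every hypothesis is a theorem of that module, so (2.47)
(`decomp247 (twCS_separates …)`, closing `example`) and d(y, y′) ≥ (2.48)₁ ≥ (2.48)₂ hold there for all sites (L ≥ 1,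
η > 0) — a coordinatised multi-level model instance with ≥ 3 levels.

TYPING ∕ DIVERGENCE.  (a) SURFACE POINTS.  `OnSurf j` is the set of lattice points of B^j(Λ_j) through which an admissible
contour can pass between B^{j−1}(Λ_{j−1}) and B^j(Λ_j); every such point lies on the printed Σ_j (dictionary above).  The
printed Σ_j ∩ lattice may contain further points through which NO admissible contour changes zone (e.g. a Λ_j-point at a
corner where two cubes of Ω_j meet only along an edge, all of whose lattice neighbours lie in the closed Ω_j); declaring such
points surface points too would only subdivide episodes of the same surface or add trivial ones, each again with the printed
properties, and every term of (2.48) stays valid — the decomposition is read here with the crossing points, which is what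
(2.48) ∕ (2.57) ∕ (2.58) use.  (b) Γ_{y,y′} = ⋃ portions of (2.47) is definitional: the portions ARE the consecutive index
intervals [0, e₁], [e_l, b_l], [b_l, e_{l+1}] of the walk (`decomp247` records the chain of indices).  (c) Print decomposes
the minimising contour; everything here holds for EVERY admissible contour (|Γ|_bonds in place of d(y, y′)), and for a
shortest one |Γ|_bonds = d(y, y′) (`ineq248_dist`, `ineq248_of_realizes`).  (d) For l = m the printed list is read with
j_{m+1} := j′ (the index sequence *"j, j₁, …, j_m, j′"*): Γ_{y′_m,y′} ⊂ B^{min{j_m,j′}}(Λ_{min{j_m,j′}}) and |j_m − j′| ≤ 1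
(= 1 is printed for consecutive SURFACES, 1 ≤ l < m); for m = 0 (no surface met) the whole contour stays in B^j(Λ_j) and
j′ = j.  (e) (len) is an inequality |bond| ≤ L^{min zone}η in the siblings (equality in print and on the tower,
`B6LevelTower.dist_tposR_eq`); (2.48) only needs ≤.  (f) |y − y′| is the distance of the drawing's ambient (pseudo)metric
space (print: T_η ⊂ ℝ^d; the tower is drawn in ℝ^d with the sup metric, `tposR`); the second line of (2.48) is the triangle
inequality there.  (g) No use of (2.2) ∕ the level gap: (2.57) and the count (2.58) are NOT touched here (rows B6.Eq2.56 ∕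
B6.Lem2.1: `B6Lemma21Bridge`, `B6TowerDecomp`, `B6Ineq258TowerD2`).

HONEST SCOPE.  Finite combinatorics of walks in a zoned graph plus the triangle inequality of a drawing: the bookkeeping
content of (2.47)–(2.48) exactly as displayed, for the typed (2.46).  It does not construct the nested domains (2.1)–(2.4) in
a torus, does not prove (2.57), (2.58), Lemma 2.1 or anything analytic, and is NOT progress on any Clay problem.
-/

namespace Literature.MathematicalPhysics.QuantumFieldTheory.Balaban1983to89.B6Decomp247Surfaces

open Literature.MathematicalPhysics.QuantumFieldTheory.Balaban1983to89
open B6Geometry B6LevelGapMetric Finset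

/-! ## 1. The surfaces Σ_j in the dictionary of `B6Geometry`, and the zone rules along admissible bonds -/

section Surfaces

variable {V : Type*} {G : SimpleGraph V} {zone : V → ℕ}

/-- **Λ_j ∩ Σ_j** (p. 231 [9]: *"A sum of faces of these cubes which are not contained in the interior of Ω_j forms a
surface. We denote this surface by Σ_j and we use the same notation for the set T^{(j)} ∩ Σ_j = Λ_j ∩ Σ_j. The surface Σ_j
separates the sets B^j(Λ_j) and B^{j−1}(Λ_{j−1})."*), in the dictionary of `B6Geometry` (zone x = j ⟺ x ∈ B^j(Λ_j),
closed-Ω convention): a lattice point of B^j(Λ_j) joined by an admissible bond to a point of B^{j−1}(Λ_{j−1}).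
[cite: Balaban1984PropagatorsII, p.231] -/
def OnSurf (G : SimpleGraph V) (zone : V → ℕ) (j : ℕ) (x : V) : Prop :=
  zone x = j ∧ ∃ u, G.Adj u x ∧ zone u + 1 = j

/-- x lies on some surface Σ_j (necessarily j = zone x). [cite: Balaban1984PropagatorsII, p.231] -/
def OnSomeSurf (G : SimpleGraph V) (zone : V → ℕ) (x : V) : Prop :=
  ∃ u, G.Adj u x ∧ zone u + 1 = zone x

/-- The surface through x, if any, is Σ_{zone x}. [cite: Balaban1984PropagatorsII, p.231] -/
theorem OnSurf.zone_eq {j : ℕ} {x : V} (h : OnSurf G zone j x) : zone x = j := h.1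

/-- Σ_j-points are surface points. [cite: Balaban1984PropagatorsII, p.231] -/
theorem OnSurf.onSomeSurf {j : ℕ} {x : V} (h : OnSurf G zone j x) : OnSomeSurf G zone x := by
  obtain ⟨hz, u, hu, hj⟩ := h
  exact ⟨u, hu, by omega⟩

/-- A surface point lies on Σ_{zone x}. [cite: Balaban1984PropagatorsII, p.231] -/
theorem onSurf_of_onSomeSurf {x : V} (h : OnSomeSurf G zone x) : OnSurf G zone (zone x) x :=
  ⟨rfl, h⟩

/-- `OnSurf j x ↔ zone x = j ∧ OnSomeSurf x`. [cite: Balaban1984PropagatorsII, p.231] -/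
theorem onSurf_iff {j : ℕ} {x : V} : OnSurf G zone j x ↔ zone x = j ∧ OnSomeSurf G zone x := by
  constructor
  · exact fun h => ⟨h.1, h.onSomeSurf⟩
  · rintro ⟨rfl, h⟩
    exact onSurf_of_onSomeSurf h

/-- The two surfaces through one point coincide. [cite: Balaban1984PropagatorsII, p.231] -/
theorem OnSurf.eq_of_onSurf {j j' : ℕ} {x : V} (h : OnSurf G zone j x) (h' : OnSurf G zone j' x) : j = j' :=
  h.1.symm.trans h'.1

/-- ZONE RULE 1 (no rise onto a surface-free point): along an admissible bond u — w with w on no surface,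
zone w ≤ zone u (a rise zone w = zone u + 1 would put w on Σ_{zone w} through u). [cite: Balaban1984PropagatorsII, p.231] -/
theorem zone_le_of_adj_of_not_onSomeSurf (hsep : Separates G zone) {u w : V} (h : G.Adj u w)
    (hw : ¬ OnSomeSurf G zone w) : zone w ≤ zone u := by
  have h1 := hsep h
  by_contra hlt
  exact hw ⟨u, h, by omega⟩

/-- ZONE RULE 2 (no drop from a surface-free point): along an admissible bond u — w with u on no surface,
zone u ≤ zone w (a drop zone w = zone u − 1 would put u on Σ_{zone u} through w). [cite: Balaban1984PropagatorsII, p.231] -/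
theorem zone_le_of_adj_of_not_onSomeSurf_left (hsep : Separates G zone) {u w : V} (h : G.Adj u w)
    (hu : ¬ OnSomeSurf G zone u) : zone u ≤ zone w := by
  have h1 := hsep h
  by_contra hlt
  exact hu ⟨w, h.symm, by omega⟩

/-- Between two surface-free points an admissible bond keeps the zone. [cite: Balaban1984PropagatorsII, p.231] -/
theorem zone_eq_of_adj_of_not_onSomeSurf (hsep : Separates G zone) {u w : V} (h : G.Adj u w)
    (hu : ¬ OnSomeSurf G zone u) (hw : ¬ OnSomeSurf G zone w) : zone u = zone w :=
  le_antisymm (zone_le_of_adj_of_not_onSomeSurf_left hsep h hu) (zone_le_of_adj_of_not_onSomeSurf hsep h hw)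

end Surfaces

/-! ## 2. Indices along a contour: the points y_l, y′_l and the surface indices j_l of (2.47) -/

section Walk

variable {V : Type*} {G : SimpleGraph V} {zone : V → ℕ} {x x' : V}

/-- The i-th point of the contour lies on some surface. [cite: Balaban1984PropagatorsII, (2.47) p.231] -/
def SurfAt (zone : V → ℕ) (p : G.Walk x x') (i : ℕ) : Prop :=
  OnSomeSurf G zone (p.getVert i)

/-- The least index i ≥ t with property P, or else an index > |Γ| (first-hitting index; *"intersects … the first time
at a point"*, p. 231). [cite: Balaban1984PropagatorsII, (2.47) p.231] -/
noncomputable def nxt (p : G.Walk x x') (t : ℕ) (P : ℕ → Prop) : ℕ :=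
  sInf {i | t ≤ i ∧ (p.length < i ∨ P i)}

/-- The first-hitting index exists and is a hit (or lies beyond the contour). [cite: Balaban1984PropagatorsII, (2.47) p.231] -/
theorem nxt_spec (p : G.Walk x x') (t : ℕ) (P : ℕ → Prop) :
    t ≤ nxt p t P ∧ (p.length < nxt p t P ∨ P (nxt p t P)) := by
  have hne : ({i | t ≤ i ∧ (p.length < i ∨ P i)} : Set ℕ).Nonempty :=
    ⟨max t (p.length + 1), le_max_left _ _, Or.inl (by omega)⟩
  exact Nat.sInf_mem hne

/-- The first-hitting index is ≥ the starting index. [cite: Balaban1984PropagatorsII, (2.47) p.231] -/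
theorem le_nxt (p : G.Walk x x') (t : ℕ) (P : ℕ → Prop) : t ≤ nxt p t P := (nxt_spec p t P).1

/-- Minimality of the first-hitting index. [cite: Balaban1984PropagatorsII, (2.47) p.231] -/
theorem nxt_le_of_mem (p : G.Walk x x') {t : ℕ} {P : ℕ → Prop} {i : ℕ} (hti : t ≤ i)
    (hi : p.length < i ∨ P i) : nxt p t P ≤ i :=
  Nat.sInf_le ⟨hti, hi⟩

/-- The first-hitting index is at most max{t, |Γ| + 1}. [cite: Balaban1984PropagatorsII, (2.47) p.231] -/
theorem nxt_le_max (p : G.Walk x x') (t : ℕ) (P : ℕ → Prop) : nxt p t P ≤ max t (p.length + 1) :=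
  nxt_le_of_mem p (le_max_left _ _) (Or.inl (by omega))

/-- A first-hitting index inside the contour is a hit. [cite: Balaban1984PropagatorsII, (2.47) p.231] -/
theorem prop_nxt_of_le (p : G.Walk x x') {t : ℕ} {P : ℕ → Prop} (h : nxt p t P ≤ p.length) : P (nxt p t P) := by
  rcases (nxt_spec p t P).2 with h' | h'
  · omega
  · exact h'

/-- No hit strictly before the first-hitting index (*"the first time"*, p. 231). [cite: Balaban1984PropagatorsII, (2.47) p.231] -/
theorem not_prop_of_lt_nxt (p : G.Walk x x') {t : ℕ} {P : ℕ → Prop} {i : ℕ} (hti : t ≤ i) (hi : i < nxt p t P) :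
    i ≤ p.length ∧ ¬ P i := by
  constructor
  · by_contra h
    have := nxt_le_of_mem p (P := P) hti (Or.inl (by omega))
    omega
  · intro hP
    have := nxt_le_of_mem p (P := P) hti (Or.inr hP)
    omega

/-- The indices of the points y_l of (2.47) along the contour (aIdx 0 = 0 is the start y; aIdx 1 = the first surface
point; aIdx (l+2) = the first point after y_{l+1} on a surface OTHER than Σ_{j_{l+1}}). [cite: Balaban1984PropagatorsII, (2.47) p.231] -/
noncomputable def aIdx (zone : V → ℕ) (p : G.Walk x x') : ℕ → ℕ
  | 0 => 0
  | 1 => nxt p 0 (SurfAt zone p)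
  | (l + 2) => nxt p (aIdx zone p (l + 1) + 1)
      (fun i => SurfAt zone p i ∧ zone (p.getVert i) ≠ zone (p.getVert (aIdx zone p (l + 1))))

/-- The surface indices j_l of (2.47): j_l = zone y_l (j₀ = j = zone y). [cite: Balaban1984PropagatorsII, (2.47) p.231] -/
noncomputable def js (zone : V → ℕ) (p : G.Walk x x') (l : ℕ) : ℕ := zone (p.getVert (aIdx zone p l))

/-- y₀ = y. [cite: Balaban1984PropagatorsII, (2.47) p.231] -/
theorem aIdx_zero (p : G.Walk x x') : aIdx zone p 0 = 0 := rfl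

/-- y₁ = the first surface point of the contour. [cite: Balaban1984PropagatorsII, (2.47) p.231] -/
theorem aIdx_one (p : G.Walk x x') : aIdx zone p 1 = nxt p 0 (SurfAt zone p) := rfl

/-- y_{l+2} = the first point after y_{l+1} on a surface other than Σ_{j_{l+1}}. [cite: Balaban1984PropagatorsII, (2.47) p.231] -/
theorem aIdx_succ_succ (p : G.Walk x x') (l : ℕ) : aIdx zone p (l + 2) = nxt p (aIdx zone p (l + 1) + 1)
    (fun i => SurfAt zone p i ∧ zone (p.getVert i) ≠ js zone p (l + 1)) := rfl

/-- j₀ = j = zone y. [cite: Balaban1984PropagatorsII, (2.47) p.231] -/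
theorem js_zero (p : G.Walk x x') : js zone p 0 = zone x := by
  simp [js, aIdx_zero]

/-- The indices y_l increase strictly from l = 1 on. [cite: Balaban1984PropagatorsII, (2.47) p.231] -/
theorem aIdx_lt_succ (p : G.Walk x x') (l : ℕ) (hl : 1 ≤ l) : aIdx zone p l < aIdx zone p (l + 1) := by
  obtain ⟨l, rfl⟩ : ∃ l', l = l' + 1 := ⟨l - 1, by omega⟩
  rw [aIdx_succ_succ]
  exact Nat.lt_of_lt_of_le (Nat.lt_succ_self _) (le_nxt p _ _)

/-- The index of y_{l+1} is at least l. [cite: Balaban1984PropagatorsII, (2.47) p.231] -/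
theorem le_aIdx (p : G.Walk x x') (l : ℕ) : l ≤ aIdx zone p (l + 1) := by
  induction l with
  | zero => exact Nat.zero_le _
  | succ l ih => have := aIdx_lt_succ (zone := zone) p (l + 1) (by omega); omega

/-- The episode indices eventually leave the contour (finitely many episodes). [cite: Balaban1984PropagatorsII, (2.47) p.231] -/
theorem exists_aIdx_gt (p : G.Walk x x') : ∃ l, p.length < aIdx zone p (l + 1) :=
  ⟨p.length + 1, by have := le_aIdx (zone := zone) p (p.length + 1); omega⟩

open Classical in
/-- **m** of (2.47): the number of surface episodes y_l … y′_l of the contour. [cite: Balaban1984PropagatorsII, (2.47) p.231] -/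
noncomputable def m (zone : V → ℕ) (p : G.Walk x x') : ℕ := Nat.find (exists_aIdx_gt (zone := zone) p)

open Classical in
/-- There is no (m+1)-st episode on the contour. [cite: Balaban1984PropagatorsII, (2.47) p.231] -/
theorem length_lt_aIdx_m_succ (p : G.Walk x x') : p.length < aIdx zone p (m zone p + 1) :=
  Nat.find_spec (exists_aIdx_gt (zone := zone) p)

open Classical in
/-- The episodes 1, …, m lie on the contour. [cite: Balaban1984PropagatorsII, (2.47) p.231] -/
theorem aIdx_le_length (p : G.Walk x x') {l : ℕ} (hl1 : 1 ≤ l) (hl : l ≤ m zone p) : aIdx zone p l ≤ p.length := by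
  obtain ⟨l, rfl⟩ : ∃ l', l = l' + 1 := ⟨l - 1, by omega⟩
  have hlt : l < m zone p := by omega
  unfold m at hlt
  have h := Nat.find_min (exists_aIdx_gt (zone := zone) p) hlt
  omega

/-- The end index of the l-th crossing portion: e l = aIdx l for l ≤ m, and e (m+1) = |Γ| (y_{m+1} = y′).
[cite: Balaban1984PropagatorsII, (2.47) p.231] -/
noncomputable def eIdx (zone : V → ℕ) (p : G.Walk x x') (l : ℕ) : ℕ := min (aIdx zone p l) p.length

/-- e_l = index of y_l for 1 ≤ l ≤ m. [cite: Balaban1984PropagatorsII, (2.47) p.231] -/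
theorem eIdx_of_le (p : G.Walk x x') {l : ℕ} (hl1 : 1 ≤ l) (hl : l ≤ m zone p) : eIdx zone p l = aIdx zone p l :=
  min_eq_left (aIdx_le_length p hl1 hl)

/-- e_{m+1} = |Γ|: y_{m+1} = y′. [cite: Balaban1984PropagatorsII, (2.47) p.231] -/
theorem eIdx_m_succ (p : G.Walk x x') : eIdx zone p (m zone p + 1) = p.length :=
  min_eq_right (length_lt_aIdx_m_succ p).le

/-- e_l ≤ |Γ|. [cite: Balaban1984PropagatorsII, (2.47) p.231] -/
theorem eIdx_le_length (p : G.Walk x x') (l : ℕ) : eIdx zone p l ≤ p.length := min_le_right _ _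

/-- The indices of the points y′_l of (2.47): the LAST point on Σ_{j_l} before the contour meets another surface
(b 0 = 0 is the start y). [cite: Balaban1984PropagatorsII, (2.47) p.231] -/
noncomputable def bIdx (zone : V → ℕ) (p : G.Walk x x') (l : ℕ) : ℕ :=
  if l = 0 then 0 else
    sSup {i | aIdx zone p l ≤ i ∧ i ≤ p.length ∧ i < aIdx zone p (l + 1) ∧ SurfAt zone p i ∧
      zone (p.getVert i) = js zone p l}

/-- b₀ = 0: y′₀ := y. [cite: Balaban1984PropagatorsII, (2.47) p.231] -/
theorem bIdx_zero (p : G.Walk x x') : bIdx zone p 0 = 0 := by simp [bIdx]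

/-! ## 3. The decomposition (2.47): the printed properties of the portions Γ_{y_l,y′_l}, Γ_{y′_l,y_{l+1}} -/

/-- Γ(e_l) = y_l (the point at index min{aIdx l, |Γ|}; beyond the contour both are y′). [cite: Balaban1984PropagatorsII, (2.47) p.231] -/
theorem getVert_eIdx (p : G.Walk x x') (l : ℕ) : p.getVert (eIdx zone p l) = p.getVert (aIdx zone p l) := by
  unfold eIdx
  rcases le_total (aIdx zone p l) p.length with h | h
  · rw [min_eq_left h]
  · rw [min_eq_right h, p.getVert_of_length_le le_rfl, p.getVert_of_length_le h]

/-- zone y_l = j_l (also for l = m + 1: zone y′ = j_{m+1}). [cite: Balaban1984PropagatorsII, (2.47) p.231] -/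
theorem zone_getVert_eIdx (p : G.Walk x x') (l : ℕ) : zone (p.getVert (eIdx zone p l)) = js zone p l := by
  rw [getVert_eIdx]; rfl

/-- j_{m+1} = j′ = zone y′. [cite: Balaban1984PropagatorsII, (2.47) p.231] -/
theorem js_m_succ (p : G.Walk x x') : js zone p (m zone p + 1) = zone x' := by
  rw [js, p.getVert_of_length_le (length_lt_aIdx_m_succ p).le]

/-- y_l (1 ≤ l ≤ m) is a surface point. [cite: Balaban1984PropagatorsII, (2.47) p.231] -/
theorem surfAt_aIdx (p : G.Walk x x') {l : ℕ} (hl1 : 1 ≤ l) (hl : l ≤ m zone p) : SurfAt zone p (aIdx zone p l) := by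
  have hle := aIdx_le_length p hl1 hl
  rcases Nat.lt_or_ge l 2 with h2 | h2
  · obtain rfl : l = 1 := by omega
    exact prop_nxt_of_le p (t := 0) (P := SurfAt zone p) hle
  · obtain ⟨l, rfl⟩ : ∃ l', l = l' + 2 := ⟨l - 2, by omega⟩
    rw [aIdx_succ_succ] at hle ⊢
    exact (prop_nxt_of_le p hle).1

/-- **y_l ∈ Σ_{j_l}** (1 ≤ l ≤ m). [cite: Balaban1984PropagatorsII, (2.47) p.231] -/
theorem onSurf_aIdx (p : G.Walk x x') {l : ℕ} (hl1 : 1 ≤ l) (hl : l ≤ m zone p) :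
    OnSurf G zone (js zone p l) (p.getVert (aIdx zone p l)) :=
  ⟨rfl, surfAt_aIdx p hl1 hl⟩

/-- The defining set of the index of y′_l. [cite: Balaban1984PropagatorsII, (2.47) p.231] -/
def bSet (zone : V → ℕ) (p : G.Walk x x') (l : ℕ) : Set ℕ :=
  {i | aIdx zone p l ≤ i ∧ i ≤ p.length ∧ i < aIdx zone p (l + 1) ∧ SurfAt zone p i ∧
    zone (p.getVert i) = js zone p l}

/-- b_l is the supremum of its defining set (l ≥ 1). [cite: Balaban1984PropagatorsII, (2.47) p.231] -/
theorem bIdx_of_pos (p : G.Walk x x') {l : ℕ} (hl1 : 1 ≤ l) : bIdx zone p l = sSup (bSet zone p l) := by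
  unfold bIdx bSet
  rw [if_neg (by omega)]

/-- The defining set of b_l is bounded by |Γ|. [cite: Balaban1984PropagatorsII, (2.47) p.231] -/
theorem bSet_bddAbove (p : G.Walk x x') (l : ℕ) : BddAbove (bSet zone p l) :=
  ⟨p.length, fun _ hi => hi.2.1⟩

/-- y_l itself is a candidate for y′_l. [cite: Balaban1984PropagatorsII, (2.47) p.231] -/
theorem aIdx_mem_bSet (p : G.Walk x x') {l : ℕ} (hl1 : 1 ≤ l) (hl : l ≤ m zone p) : aIdx zone p l ∈ bSet zone p l :=
  ⟨le_rfl, aIdx_le_length p hl1 hl, aIdx_lt_succ p l hl1, surfAt_aIdx p hl1 hl, rfl⟩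

/-- y′_l is attained: the LAST point on Σ_{j_l} before another surface. [cite: Balaban1984PropagatorsII, (2.47) p.231] -/
theorem bIdx_mem_bSet (p : G.Walk x x') {l : ℕ} (hl1 : 1 ≤ l) (hl : l ≤ m zone p) : bIdx zone p l ∈ bSet zone p l := by
  rw [bIdx_of_pos p hl1]
  exact Nat.sSup_mem ⟨_, aIdx_mem_bSet p hl1 hl⟩ (bSet_bddAbove p l)

/-- Maximality of y′_l. [cite: Balaban1984PropagatorsII, (2.47) p.231] -/
theorem le_bIdx_of_mem_bSet (p : G.Walk x x') {l i : ℕ} (hl1 : 1 ≤ l) (hi : i ∈ bSet zone p l) : i ≤ bIdx zone p l := by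
  rw [bIdx_of_pos p hl1]
  exact le_csSup (bSet_bddAbove p l) hi

/-- y_l comes no later than y′_l. [cite: Balaban1984PropagatorsII, (2.47) p.231] -/
theorem aIdx_le_bIdx (p : G.Walk x x') {l : ℕ} (hl1 : 1 ≤ l) (hl : l ≤ m zone p) : aIdx zone p l ≤ bIdx zone p l :=
  le_bIdx_of_mem_bSet p hl1 (aIdx_mem_bSet p hl1 hl)

/-- y′_l lies on the contour. [cite: Balaban1984PropagatorsII, (2.47) p.231] -/
theorem bIdx_le_length (p : G.Walk x x') {l : ℕ} (hl : l ≤ m zone p) : bIdx zone p l ≤ p.length := by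
  rcases Nat.eq_zero_or_pos l with rfl | hl1
  · rw [bIdx_zero]; exact Nat.zero_le _
  · exact (bIdx_mem_bSet p hl1 hl).2.1

/-- y′_l comes strictly before y_{l+1}. [cite: Balaban1984PropagatorsII, (2.47) p.231] -/
theorem bIdx_lt_aIdx_succ (p : G.Walk x x') {l : ℕ} (hl1 : 1 ≤ l) (hl : l ≤ m zone p) :
    bIdx zone p l < aIdx zone p (l + 1) :=
  (bIdx_mem_bSet p hl1 hl).2.2.1

/-- b_l ≤ e_{l+1} (l ≤ m). [cite: Balaban1984PropagatorsII, (2.47) p.231] -/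
theorem bIdx_le_eIdx_succ (p : G.Walk x x') {l : ℕ} (hl : l ≤ m zone p) : bIdx zone p l ≤ eIdx zone p (l + 1) := by
  rcases Nat.eq_zero_or_pos l with rfl | hl1
  · rw [bIdx_zero]; exact Nat.zero_le _
  · exact le_min (bIdx_lt_aIdx_succ p hl1 hl).le (bIdx_le_length p hl)

/-- e_l ≤ b_l (1 ≤ l ≤ m). [cite: Balaban1984PropagatorsII, (2.47) p.231] -/
theorem eIdx_le_bIdx (p : G.Walk x x') {l : ℕ} (hl1 : 1 ≤ l) (hl : l ≤ m zone p) : eIdx zone p l ≤ bIdx zone p l := by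
  rw [eIdx_of_le p hl1 hl]; exact aIdx_le_bIdx p hl1 hl

/-- **y′_l ∈ Σ_{j_l}** (1 ≤ l ≤ m). [cite: Balaban1984PropagatorsII, (2.47) p.231] -/
theorem onSurf_bIdx (p : G.Walk x x') {l : ℕ} (hl1 : 1 ≤ l) (hl : l ≤ m zone p) :
    OnSurf G zone (js zone p l) (p.getVert (bIdx zone p l)) :=
  have h := bIdx_mem_bSet p hl1 hl
  onSurf_iff.mpr ⟨h.2.2.2.2, h.2.2.2.1⟩

/-- zone y′_l = j_l (l ≤ m; y′₀ = y). [cite: Balaban1984PropagatorsII, (2.47) p.231] -/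
theorem zone_getVert_bIdx (p : G.Walk x x') {l : ℕ} (hl : l ≤ m zone p) : zone (p.getVert (bIdx zone p l)) = js zone p l := by
  rcases Nat.eq_zero_or_pos l with rfl | hl1
  · rw [bIdx_zero, js_zero, p.getVert_zero]
  · exact (onSurf_bIdx p hl1 hl).1

/-- The portion Γ_{y,y₁} before the first surface point meets no surface (y₁ = *"the first time"*).
[cite: Balaban1984PropagatorsII, (2.47) p.231] -/
theorem not_surfAt_of_lt_aIdx_one (p : G.Walk x x') {i : ℕ} (hi : i < aIdx zone p 1) : ¬ SurfAt zone p i :=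
  (not_prop_of_lt_nxt p (t := 0) (P := SurfAt zone p) (Nat.zero_le i) hi).2

/-- The interior of the crossing portion Γ_{y′_l,y_{l+1}} meets no surface at all (y′_l is the LAST point on Σ_{j_l},
y_{l+1} the FIRST point on another surface). [cite: Balaban1984PropagatorsII, (2.47) p.231] -/
theorem not_surfAt_X (p : G.Walk x x') {l i : ℕ} (hl : l ≤ m zone p) (h1 : bIdx zone p l < i)
    (h2 : i < aIdx zone p (l + 1)) (hin : i ≤ p.length) : ¬ SurfAt zone p i := by
  rcases Nat.eq_zero_or_pos l with rfl | hl1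
  · exact not_surfAt_of_lt_aIdx_one p h2
  · intro hs
    by_cases hz : zone (p.getVert i) = js zone p l
    · have hmem : i ∈ bSet zone p l := ⟨(aIdx_le_bIdx p hl1 hl).trans h1.le, hin, h2, hs, hz⟩
      exact absurd (le_bIdx_of_mem_bSet p hl1 hmem) (by omega)
    · obtain ⟨l, rfl⟩ : ∃ l', l = l' + 1 := ⟨l - 1, by omega⟩
      rw [aIdx_succ_succ] at h2
      have hai : aIdx zone p (l + 1) + 1 ≤ i := by
        have := aIdx_le_bIdx p hl1 hl
        omega
      have := nxt_le_of_mem p (P := fun i => SurfAt zone p i ∧ zone (p.getVert i) ≠ js zone p (l + 1)) hai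
        (Or.inr ⟨hs, hz⟩)
      omega

/-- After y′_m the contour meets no surface (up to and including y′). [cite: Balaban1984PropagatorsII, (2.47) p.231] -/
theorem not_surfAt_tail (p : G.Walk x x') {i : ℕ} (h1 : bIdx zone p (m zone p) < i) (hin : i ≤ p.length) :
    ¬ SurfAt zone p i :=
  not_surfAt_X p le_rfl h1 (Nat.lt_of_le_of_lt hin (length_lt_aIdx_m_succ p)) hin

/-- **Γ_{y_l,y′_l} does not intersect any other surface Σ_j, j ≠ j_l.** [cite: Balaban1984PropagatorsII, (2.47) p.231] -/
theorem zone_eq_js_of_surfAt_S (p : G.Walk x x') {l i : ℕ} (hl1 : 1 ≤ l) (hl : l ≤ m zone p)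
    (h1 : aIdx zone p l ≤ i) (h2 : i ≤ bIdx zone p l) (hs : SurfAt zone p i) : zone (p.getVert i) = js zone p l := by
  rcases h1.eq_or_lt with h | h
  · rw [← h]; rfl
  · by_contra hz
    obtain ⟨l, rfl⟩ : ∃ l', l = l' + 1 := ⟨l - 1, by omega⟩
    have hlt := bIdx_lt_aIdx_succ p hl1 hl
    rw [aIdx_succ_succ] at hlt
    have := nxt_le_of_mem p (P := fun i => SurfAt zone p i ∧ zone (p.getVert i) ≠ js zone p (l + 1))
      (show aIdx zone p (l + 1) + 1 ≤ i by omega) (Or.inr ⟨hs, hz⟩)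
    omega

/-- No point of Γ_{y_l,y′_l} lies on a surface Σ_j with j ≠ j_l. [cite: Balaban1984PropagatorsII, (2.47) p.231] -/
theorem not_onSurf_S (p : G.Walk x x') {l i j : ℕ} (hl1 : 1 ≤ l) (hl : l ≤ m zone p)
    (h1 : aIdx zone p l ≤ i) (h2 : i ≤ bIdx zone p l) (hj : j ≠ js zone p l) : ¬ OnSurf G zone j (p.getVert i) :=
  fun h => hj (h.1.symm.trans (zone_eq_js_of_surfAt_S p hl1 hl h1 h2 h.onSomeSurf))

/-- Consecutive episodes sit on DIFFERENT surfaces. [cite: Balaban1984PropagatorsII, (2.47) p.231] -/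
theorem js_succ_ne (p : G.Walk x x') {l : ℕ} (hl1 : 1 ≤ l) (hl : l + 1 ≤ m zone p) :
    js zone p (l + 1) ≠ js zone p l := by
  obtain ⟨l, rfl⟩ : ∃ l', l = l' + 1 := ⟨l - 1, by omega⟩
  have hle := aIdx_le_length p (l := l + 2) (by omega) hl
  rw [aIdx_succ_succ] at hle
  have h := (prop_nxt_of_le p hle).2
  rw [js, aIdx_succ_succ]
  exact h

/-- THE SURFACE-FREE STRETCH LEMMA: along a portion v_s … v_t of the contour whose interior points lie on no surface,
and whose end-points are not both points of one and the same surface, every bond has zone min{zone v_s, zone v_t},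
the end zones differ by at most one, a surface-free start is the lower end and a surface-free finish is the lower end.
[cite: Balaban1984PropagatorsII, (2.47) p.231] -/
theorem stretch (hsep : Separates G zone) (p : G.Walk x x') {s t : ℕ} (hst : s ≤ t) (htn : t ≤ p.length)
    (hfree : ∀ i, s < i → i < t → ¬ SurfAt zone p i)
    (hexcl : s < t → SurfAt zone p s → SurfAt zone p t → zone (p.getVert s) ≠ zone (p.getVert t)) :
    (∀ i, s ≤ i → i < t → min (zone (p.getVert i)) (zone (p.getVert (i + 1)))
        = min (zone (p.getVert s)) (zone (p.getVert t))) ∧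
    zone (p.getVert s) ≤ zone (p.getVert t) + 1 ∧ zone (p.getVert t) ≤ zone (p.getVert s) + 1 ∧
    (s < t → ¬ SurfAt zone p s → zone (p.getVert s) ≤ zone (p.getVert t)) ∧
    (s < t → ¬ SurfAt zone p t → zone (p.getVert t) ≤ zone (p.getVert s)) := by
  have hadj : ∀ i, i < t → G.Adj (p.getVert i) (p.getVert (i + 1)) := fun i hi =>
    p.adj_getVert_succ (by omega)
  rcases hst.eq_or_lt with rfl | hlt
  · refine ⟨fun i h1 h2 => by omega, by omega, by omega, fun h => by omega, fun h => by omega⟩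
  -- the interior is zone-constant
  have hconst : ∀ i, s < i → i < t → zone (p.getVert i) = zone (p.getVert (s + 1)) := by
    intro i hi1 hi2
    induction i, hi1 using Nat.le_induction with
    | base => rfl
    | succ i hsi ih =>
      have h := zone_eq_of_adj_of_not_onSomeSurf hsep (hadj i (by omega)) (hfree i hsi (by omega))
        (hfree (i + 1) (by omega) hi2)
      rw [← h, ih (by omega)]
  by_cases h1 : t = s + 1
  · subst h1
    have hb := hsep (hadj s (by omega))
    refine ⟨fun i hi1 hi2 => ?_, hb.2, hb.1, fun _ hs => ?_, fun _ ht => ?_⟩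
    · obtain rfl : i = s := by omega
      rfl
    · exact zone_le_of_adj_of_not_onSomeSurf_left hsep (hadj s (by omega)) hs
    · exact zone_le_of_adj_of_not_onSomeSurf hsep (hadj s (by omega)) ht
  · have h2 : s + 2 ≤ t := by omega
    set z := zone (p.getVert (s + 1)) with hz
    have hfs : ¬ SurfAt zone p (s + 1) := hfree (s + 1) (by omega) (by omega)
    have hft : ¬ SurfAt zone p (t - 1) := hfree (t - 1) (by omega) (by omega)
    have hzt1 : zone (p.getVert (t - 1)) = z := hconst (t - 1) (by omega) (by omega)
    have hadj0 := hadj s (by omega)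
    have hadj1 : G.Adj (p.getVert (t - 1)) (p.getVert t) := by
      have := hadj (t - 1) (by omega)
      rwa [show t - 1 + 1 = t by omega] at this
    -- first bond: no rise onto the surface-free v_{s+1}
    have hs1 : z ≤ zone (p.getVert s) := zone_le_of_adj_of_not_onSomeSurf hsep hadj0 hfs
    have hs2 : zone (p.getVert s) ≤ z + 1 := (hsep hadj0).2
    -- last bond: no drop from the surface-free v_{t-1}
    have ht1 : z ≤ zone (p.getVert t) := by
      have := zone_le_of_adj_of_not_onSomeSurf_left hsep hadj1 hft
      omega
    have ht2 : zone (p.getVert t) ≤ z + 1 := by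
      have := (hsep hadj1).1
      omega
    -- an upper end-point is a surface point
    have hsurf_s : zone (p.getVert s) = z + 1 → SurfAt zone p s := fun h =>
      ⟨p.getVert (s + 1), hadj0.symm, by omega⟩
    have hsurf_t : zone (p.getVert t) = z + 1 → SurfAt zone p t := fun h =>
      ⟨p.getVert (t - 1), hadj1, by omega⟩
    have hnotboth : ¬ (zone (p.getVert s) = z + 1 ∧ zone (p.getVert t) = z + 1) := fun h =>
      hexcl hlt (hsurf_s h.1) (hsurf_t h.2) (by omega)
    have hmin : min (zone (p.getVert s)) (zone (p.getVert t)) = z := by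
      rcases Nat.lt_or_ge (zone (p.getVert s)) (z + 1) with h | h
      · have : zone (p.getVert s) = z := by omega
        rw [this]; exact min_eq_left ht1
      · have hs' : zone (p.getVert s) = z + 1 := by omega
        have : zone (p.getVert t) = z := by
          by_contra hne
          exact hnotboth ⟨hs', by omega⟩
        rw [this]; exact min_eq_right hs1
    refine ⟨fun i hi1 hi2 => ?_, by omega, by omega, fun _ hs => ?_, fun _ ht => ?_⟩
    · rw [hmin]
      rcases hi1.eq_or_lt with rfl | hi1'
      · rw [← hz]; exact min_eq_right hs1
      · rw [hconst i hi1' hi2]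
        by_cases hit : i + 1 = t
        · rw [hit]; exact min_eq_left ht1
        · rw [hconst (i + 1) (by omega) (by omega)]; exact min_self z
    · have := zone_le_of_adj_of_not_onSomeSurf_left hsep hadj0 hs
      omega
    · have := zone_le_of_adj_of_not_onSomeSurf hsep hadj1 ht
      omega

/-- **The crossing portion Γ_{y′_l,y_{l+1}} (l = 0, …, m; y′₀ = y, y_{m+1} = y′) is contained in B^{j_{l,l+1}}(Λ_{j_{l,l+1}}),
j_{l,l+1} = min{j_l, j_{l+1}}**: every bond of it is a Λ_{j_{l,l+1}}-bond; and |j_l − j_{l+1}| ≤ 1.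
[cite: Balaban1984PropagatorsII, (2.47) p.231] -/
theorem X_facts (hsep : Separates G zone) (p : G.Walk x x') {l : ℕ} (hl : l ≤ m zone p) :
    (∀ i, bIdx zone p l ≤ i → i < eIdx zone p (l + 1) →
      min (zone (p.getVert i)) (zone (p.getVert (i + 1))) = min (js zone p l) (js zone p (l + 1))) ∧
    js zone p l ≤ js zone p (l + 1) + 1 ∧ js zone p (l + 1) ≤ js zone p l + 1 := by
  have hst := bIdx_le_eIdx_succ p hl
  have htn := eIdx_le_length (zone := zone) p (l + 1)
  have hfree : ∀ i, bIdx zone p l < i → i < eIdx zone p (l + 1) → ¬ SurfAt zone p i := fun i h1 h2 =>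
    not_surfAt_X p hl h1 (Nat.lt_of_lt_of_le h2 (min_le_left _ _)) (by omega)
  have hexcl : bIdx zone p l < eIdx zone p (l + 1) → SurfAt zone p (bIdx zone p l) →
      SurfAt zone p (eIdx zone p (l + 1)) → zone (p.getVert (bIdx zone p l)) ≠ zone (p.getVert (eIdx zone p (l + 1))) := by
    intro hlt hs ht
    rcases Nat.eq_zero_or_pos l with rfl | hl1
    · -- y itself is surface-free (else a₁ = 0 = b₀)
      exfalso
      rw [bIdx_zero] at hs hlt
      exact not_surfAt_of_lt_aIdx_one p (Nat.lt_of_lt_of_le hlt (min_le_left _ _)) hs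
    · rcases Nat.lt_or_ge (l + 1) (m zone p + 1) with hlm | hlm
      · -- next episode: a different surface
        rw [zone_getVert_bIdx (zone := zone) p hl, zone_getVert_eIdx (zone := zone) p (l + 1)]
        exact (js_succ_ne p hl1 (by omega)).symm
      · -- the tail: y′ is surface-free
        exfalso
        obtain rfl : l = m zone p := by omega
        rw [eIdx_m_succ] at ht hlt
        exact not_surfAt_tail p hlt le_rfl ht
  obtain ⟨hmin, h1, h2, -, -⟩ := stretch hsep p hst htn hfree hexcl
  rw [zone_getVert_bIdx (zone := zone) p hl, zone_getVert_eIdx (zone := zone) p (l + 1)] at hmin h1 h2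
  exact ⟨hmin, h1, h2⟩

/-- **y₁ ∈ Σ_j ∪ Σ_{j+1}**: j ≤ j₁ ≤ j + 1 (y surface-free is the lower end of Γ_{y,y₁}). [cite: Balaban1984PropagatorsII, (2.47) p.231] -/
theorem js_one_bounds (hsep : Separates G zone) (p : G.Walk x x') :
    zone x ≤ js zone p 1 ∧ js zone p 1 ≤ zone x + 1 := by
  have hX := X_facts hsep p (l := 0) (Nat.zero_le _)
  rw [js_zero] at hX
  refine ⟨?_, hX.2.2⟩
  rcases Nat.eq_zero_or_pos (eIdx zone p 1) with h0 | hpos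
  · have : js zone p 1 = zone x := by rw [← zone_getVert_eIdx (zone := zone) p 1, h0, p.getVert_zero]
    omega
  · have hfree : ∀ i, 0 < i → i < eIdx zone p 1 → ¬ SurfAt zone p i := fun i _ h2 =>
      not_surfAt_of_lt_aIdx_one p (Nat.lt_of_lt_of_le h2 (min_le_left _ _))
    have h0 : ¬ SurfAt zone p 0 := not_surfAt_of_lt_aIdx_one p (Nat.lt_of_lt_of_le hpos (min_le_left _ _))
    obtain ⟨-, -, -, h, -⟩ := stretch hsep p (Nat.zero_le _) (eIdx_le_length p 1) hfree (fun _ hs => absurd hs h0)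
    have := h hpos h0
    rwa [p.getVert_zero, zone_getVert_eIdx (zone := zone) p 1] at this

/-- **The last surface is Σ_{j′} or Σ_{j′+1}**: j′ ≤ j_m ≤ j′ + 1 (y′ surface-free is the lower end of Γ_{y′_m,y′};
for m = 0 this reads j′ ≤ j ≤ j′ + 1). [cite: Balaban1984PropagatorsII, (2.47) p.231] -/
theorem js_m_bounds (hsep : Separates G zone) (p : G.Walk x x') :
    zone x' ≤ js zone p (m zone p) ∧ js zone p (m zone p) ≤ zone x' + 1 := by
  have hX := X_facts hsep p (l := m zone p) le_rfl
  rw [js_m_succ] at hX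
  refine ⟨?_, hX.2.1⟩
  set s := bIdx zone p (m zone p)
  have hsn : s ≤ p.length := bIdx_le_length p le_rfl
  rcases hsn.eq_or_lt with h | hlt
  · have : js zone p (m zone p) = zone x' := by
      rw [← zone_getVert_bIdx (zone := zone) p le_rfl, show bIdx zone p (m zone p) = s from rfl, h, p.getVert_of_length_le le_rfl]
    omega
  · have hfree : ∀ i, s < i → i < p.length → ¬ SurfAt zone p i := fun i h1 h2 => not_surfAt_tail p h1 h2.le
    have hn : ¬ SurfAt zone p p.length := not_surfAt_tail p hlt le_rfl
    obtain ⟨-, -, -, -, h⟩ := stretch hsep p hsn le_rfl hfree (fun _ _ ht => absurd ht hn)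
    have := h hlt hn
    rwa [p.getVert_of_length_le le_rfl, zone_getVert_bIdx (zone := zone) p le_rfl] at this

/-- **|j_l − j_{l+1}| = 1** for consecutive episodes (1 ≤ l < m). [cite: Balaban1984PropagatorsII, (2.47) p.231] -/
theorem js_step (hsep : Separates G zone) (p : G.Walk x x') {l : ℕ} (hl1 : 1 ≤ l) (hl : l + 1 ≤ m zone p) :
    js zone p (l + 1) + 1 = js zone p l ∨ js zone p l + 1 = js zone p (l + 1) := by
  have hX := X_facts hsep p (l := l) (by omega)
  have hne := js_succ_ne p hl1 hl
  omega

/-- **Γ_{y_l,y′_l} is contained in B^{j_l}(Λ_{j_l}) ∪ B^{j_l−1}(Λ_{j_l−1})**: every point of it has zone j_l or j_l − 1.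
[cite: Balaban1984PropagatorsII, (2.47) p.231] -/
theorem S_zone (hsep : Separates G zone) (p : G.Walk x x') {l : ℕ} (hl1 : 1 ≤ l) (hl : l ≤ m zone p) :
    ∀ i, aIdx zone p l ≤ i → i ≤ bIdx zone p l →
      zone (p.getVert i) ≤ js zone p l ∧ js zone p l ≤ zone (p.getVert i) + 1 := by
  intro i hi1 hi2
  induction i, hi1 using Nat.le_induction with
  | base => exact ⟨le_of_eq rfl, by simp [js]⟩
  | succ i hai ih =>
    have ih' := ih (by omega)
    have hbn := bIdx_le_length p hl
    have hadj : G.Adj (p.getVert i) (p.getVert (i + 1)) := p.adj_getVert_succ (by omega)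
    have hb := hsep hadj
    rcases Nat.lt_trichotomy (zone (p.getVert (i + 1))) (zone (p.getVert i)) with h | h | h
    · -- a drop: v_i is on Σ_{zone v_i} = Σ_{j_l}
      have hs : SurfAt zone p i := ⟨p.getVert (i + 1), hadj.symm, by omega⟩
      have := zone_eq_js_of_surfAt_S p hl1 hl hai (by omega) hs
      omega
    · rw [h]; exact ih'
    · -- a rise: v_{i+1} is on Σ_{zone v_{i+1}} = Σ_{j_l}
      have hs : SurfAt zone p (i + 1) := ⟨p.getVert i, hadj, by omega⟩
      have := zone_eq_js_of_surfAt_S p hl1 hl (by omega) hi2 hs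
      omega

/-- Hence every bond of Γ_{y_l,y′_l} is a Λ_{j_l}- or a Λ_{j_l−1}-bond. [cite: Balaban1984PropagatorsII, (2.47) p.231] -/
theorem S_bond_le (hsep : Separates G zone) (p : G.Walk x x') {l : ℕ} (hl1 : 1 ≤ l) (hl : l ≤ m zone p)
    {i : ℕ} (hi1 : aIdx zone p l ≤ i) (hi2 : i < bIdx zone p l) :
    min (zone (p.getVert i)) (zone (p.getVert (i + 1))) ≤ js zone p l :=
  min_le_of_left_le (S_zone hsep p hl1 hl i hi1 hi2.le).1

end Walk

/-! ## 4. (2.48): the lengths of the portions and the distances of their end-points bound d(y, y′) from below -/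

section Metric

variable {V : Type*} {G : SimpleGraph V} {zone : V → ℕ} {x x' : V}
variable {X : Type*} [PseudoMetricSpace X]

/-- |Γ_{v_s,v_t}|: the length, in the ambient (pseudo)metric of T_η, of the portion v_s … v_t of the contour
(p. 231 *"|Γ| = nη, where n is a number of bonds the contour Γ consists of"* — the sum of the lengths of its bonds).
[cite: Balaban1984PropagatorsII, p.231] -/
noncomputable def len (pos : V → X) (p : G.Walk x x') (s t : ℕ) : ℝ :=
  ∑ i ∈ Finset.Ico s t, dist (pos (p.getVert i)) (pos (p.getVert (i + 1)))

/-- Lengths |Γ_portion| are non-negative. [cite: Balaban1984PropagatorsII, (2.48) p.232] -/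
theorem len_nonneg (pos : V → X) (p : G.Walk x x') (s t : ℕ) : 0 ≤ len pos p s t :=
  Finset.sum_nonneg fun _ _ => dist_nonneg

/-- **(2.48), second step**: *"|Γ_{y′_l,y_{l+1}}| ≥ |y′_l − y_{l+1}|"* — a portion is at least as long as its end-points
are apart (triangle inequality). [cite: Balaban1984PropagatorsII, (2.48) p.232] -/
theorem dist_le_len (pos : V → X) (p : G.Walk x x') {s t : ℕ} (hst : s ≤ t) :
    dist (pos (p.getVert s)) (pos (p.getVert t)) ≤ len pos p s t := by
  induction t, hst using Nat.le_induction with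
  | base => simp [len]
  | succ t hst ih =>
    rw [len, Finset.sum_Ico_succ_top hst, ← len]
    calc dist (pos (p.getVert s)) (pos (p.getVert (t + 1)))
        ≤ dist (pos (p.getVert s)) (pos (p.getVert t)) + dist (pos (p.getVert t)) (pos (p.getVert (t + 1))) :=
          dist_triangle _ _ _
      _ ≤ len pos p s t + dist (pos (p.getVert t)) (pos (p.getVert (t + 1))) := by linarith

/-- A portion of t − s bonds each of length ≤ c has length |Γ_portion| ≤ (t − s)·c (p. 231 *"|Γ| = nη"*). [cite: Balaban1984PropagatorsII, (2.48) p.232] -/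
theorem len_le_of_bonds (pos : V → X) (p : G.Walk x x') {s t : ℕ} (hst : s ≤ t) {c : ℝ}
    (h : ∀ i, s ≤ i → i < t → dist (pos (p.getVert i)) (pos (p.getVert (i + 1))) ≤ c) :
    len pos p s t ≤ ((t : ℝ) - s) * c := by
  unfold len
  calc ∑ i ∈ Finset.Ico s t, dist (pos (p.getVert i)) (pos (p.getVert (i + 1)))
      ≤ ∑ i ∈ Finset.Ico s t, c := Finset.sum_le_sum fun i hi => by
          rw [Finset.mem_Ico] at hi; exact h i hi.1 hi.2
    _ = ((t : ℝ) - s) * c := by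
          rw [Finset.sum_const, Nat.card_Ico, nsmul_eq_mul, Nat.cast_sub hst]

variable {pos : V → X} {ℓ : ℕ → ℝ}

/-- **(2.48), first step, one portion**: *"From this decomposition and the definition (2.46) we get d(y,y′) ≥
(L^jη)^{−1}|Γ_{y,y₁}| + …"* — a portion of the contour all of whose bonds are Λ_{j′}-bonds with j′ ≤ q consists of at
least (L^qη)^{−1}|Γ_portion| admissible bonds ((len): a Λ_{j′}-bond has length ℓ j′ = L^{j′}η ≤ ℓ q).
[cite: Balaban1984PropagatorsII, (2.48) p.232] -/
theorem inv_mul_len_le (hlen : BondScale G zone pos ℓ) (hmono : Monotone ℓ) (hℓ : ∀ q, 0 < ℓ q)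
    (p : G.Walk x x') {s t q : ℕ} (hst : s ≤ t) (htn : t ≤ p.length)
    (hq : ∀ i, s ≤ i → i < t → min (zone (p.getVert i)) (zone (p.getVert (i + 1))) ≤ q) :
    (ℓ q)⁻¹ * len pos p s t ≤ (t : ℝ) - s := by
  rw [inv_mul_le_iff₀ (hℓ q), mul_comm]
  refine len_le_of_bonds pos p hst fun i hi1 hi2 => ?_
  exact (hlen (p.adj_getVert_succ (by omega))).trans (hmono (hq i hi1 hi2))

/-- **(2.48), FIRST LINE** (p. 232 [10], verbatim: *"From this decomposition and the definition (2.46) we get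
d(y, y′) ≥ (L^jη)^{−1}|Γ_{y,y₁}| + Σ_{l=1}^m (L^{j_l}η)^{−1}|Γ_{y_l,y′_l}| + Σ_{l=1}^m (L^{j_{l,l+1}}η)^{−1}|Γ_{y′_l,y_{l+1}}|"*),
KERNEL-DERIVED for EVERY admissible contour Γ from y to y′ in place of the minimising one (its number of admissible
bonds |Γ|_bonds ≥ the right-hand side; for a shortest contour |Γ|_bonds = d(y, y′), `ineq248_dist`), over a zoned graph
of admissible bonds with Σ_j separating (`B6Geometry.Separates`) and drawn with bond lengths ≤ ℓ (zone) (`BondScale`,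
ℓ monotone and positive; ℓ j = L^jη in print): j = zone y, m, y_l = Γ(e_l), y′_l = Γ(b_l), j_l as constructed in §2.
[cite: Balaban1984PropagatorsII, (2.48) p.232] -/
theorem ineq248_line1 (hsep : Separates G zone) (hlen : BondScale G zone pos ℓ) (hmono : Monotone ℓ)
    (hℓ : ∀ q, 0 < ℓ q) (p : G.Walk x x') :
    (ℓ (zone x))⁻¹ * len pos p 0 (eIdx zone p 1)
      + ∑ l ∈ Finset.Icc 1 (m zone p), (ℓ (js zone p l))⁻¹ * len pos p (eIdx zone p l) (bIdx zone p l)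
      + ∑ l ∈ Finset.Icc 1 (m zone p),
          (ℓ (min (js zone p l) (js zone p (l + 1))))⁻¹ * len pos p (bIdx zone p l) (eIdx zone p (l + 1))
      ≤ (p.length : ℝ) := by
  set M := m zone p with hM
  set e := eIdx zone p with he
  set b := bIdx zone p with hb
  -- the three families of portions, bond by bond
  have h0 : (ℓ (zone x))⁻¹ * len pos p 0 (e 1) ≤ (e 1 : ℝ) - (0 : ℕ) := by
    have hX := (X_facts hsep p (l := 0) (Nat.zero_le _)).1
    have hj := (js_one_bounds hsep p).1
    rw [js_zero, bIdx_zero] at hX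
    refine inv_mul_len_le hlen hmono hℓ p (Nat.zero_le _) (eIdx_le_length p 1) fun i hi1 hi2 => ?_
    rw [hX i hi1 hi2]
    exact min_le_left _ _
  have hS : ∀ l ∈ Finset.Icc 1 M, (ℓ (js zone p l))⁻¹ * len pos p (e l) (b l) ≤ (b l : ℝ) - e l := by
    intro l hl
    rw [Finset.mem_Icc] at hl
    rw [he, eIdx_of_le p hl.1 hl.2]
    exact inv_mul_len_le hlen hmono hℓ p (aIdx_le_bIdx p hl.1 hl.2) (bIdx_le_length p hl.2)
      fun i hi1 hi2 => S_bond_le hsep p hl.1 hl.2 hi1 hi2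
  have hXl : ∀ l ∈ Finset.Icc 1 M,
      (ℓ (min (js zone p l) (js zone p (l + 1))))⁻¹ * len pos p (b l) (e (l + 1)) ≤ (e (l + 1) : ℝ) - b l := by
    intro l hl
    rw [Finset.mem_Icc] at hl
    have hX := (X_facts hsep p (l := l) hl.2).1
    exact inv_mul_len_le hlen hmono hℓ p (bIdx_le_eIdx_succ p hl.2) (eIdx_le_length p (l + 1))
      fun i hi1 hi2 => (hX i hi1 hi2).le
  -- telescoping: e 1 + Σ_{l=1}^m (e (l+1) − e l) = e (m+1) = |Γ|
  have htel : ∑ l ∈ Finset.Icc 1 M, ((e (l + 1) : ℝ) - e l) = (e (M + 1) : ℝ) - e 1 := by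
    rw [← Finset.Ico_add_one_right_eq_Icc, Finset.sum_Ico_eq_sum_range]
    simp only [Nat.add_sub_cancel]
    have := Finset.sum_range_sub (fun i => (e (i + 1) : ℝ)) M
    simpa [add_comm, add_assoc] using this
  have hend : (e (M + 1) : ℝ) = p.length := by rw [he, hM, eIdx_m_succ]
  calc (ℓ (zone x))⁻¹ * len pos p 0 (e 1)
        + ∑ l ∈ Finset.Icc 1 M, (ℓ (js zone p l))⁻¹ * len pos p (e l) (b l)
        + ∑ l ∈ Finset.Icc 1 M, (ℓ (min (js zone p l) (js zone p (l + 1))))⁻¹ * len pos p (b l) (e (l + 1))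
      ≤ ((e 1 : ℝ) - (0 : ℕ)) + ∑ l ∈ Finset.Icc 1 M, ((b l : ℝ) - e l)
        + ∑ l ∈ Finset.Icc 1 M, ((e (l + 1) : ℝ) - b l) :=
          add_le_add (add_le_add h0 (Finset.sum_le_sum hS)) (Finset.sum_le_sum hXl)
    _ = (e 1 : ℝ) + ∑ l ∈ Finset.Icc 1 M, ((e (l + 1) : ℝ) - e l) := by
          rw [Nat.cast_zero, sub_zero, add_assoc, ← Finset.sum_add_distrib]
          congr 1
          exact Finset.sum_congr rfl fun l _ => by ring
    _ = (p.length : ℝ) := by rw [htel, hend]; ring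

/-- **(2.48), SECOND LINE** (p. 232 [10], verbatim: *"≥ (L^jη)^{−1}|y − y₁| + Σ_{l=1}^m (L^{j_l}η)^{−1}|y_l − y′_l| +
Σ_{l=1}^m (L^{j_{l,l+1}}η)^{−1}|y′_l − y_{l+1}|. (2.48)"*): each portion is at least as long as its end-points are
apart. [cite: Balaban1984PropagatorsII, (2.48) p.232] -/
theorem ineq248_line2 (hℓ : ∀ q, 0 < ℓ q) (p : G.Walk x x') :
    (ℓ (zone x))⁻¹ * dist (pos x) (pos (p.getVert (eIdx zone p 1)))
      + ∑ l ∈ Finset.Icc 1 (m zone p),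
          (ℓ (js zone p l))⁻¹ * dist (pos (p.getVert (eIdx zone p l))) (pos (p.getVert (bIdx zone p l)))
      + ∑ l ∈ Finset.Icc 1 (m zone p), (ℓ (min (js zone p l) (js zone p (l + 1))))⁻¹
          * dist (pos (p.getVert (bIdx zone p l))) (pos (p.getVert (eIdx zone p (l + 1))))
      ≤ (ℓ (zone x))⁻¹ * len pos p 0 (eIdx zone p 1)
      + ∑ l ∈ Finset.Icc 1 (m zone p), (ℓ (js zone p l))⁻¹ * len pos p (eIdx zone p l) (bIdx zone p l)
      + ∑ l ∈ Finset.Icc 1 (m zone p),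
          (ℓ (min (js zone p l) (js zone p (l + 1))))⁻¹ * len pos p (bIdx zone p l) (eIdx zone p (l + 1)) := by
  have hw : ∀ q, 0 ≤ (ℓ q)⁻¹ := fun q => inv_nonneg.mpr (hℓ q).le
  refine add_le_add (add_le_add ?_ (Finset.sum_le_sum fun l hl => ?_)) (Finset.sum_le_sum fun l hl => ?_)
  · have := dist_le_len pos p (Nat.zero_le (eIdx zone p 1))
    rw [p.getVert_zero] at this
    exact mul_le_mul_of_nonneg_left this (hw _)
  · rw [Finset.mem_Icc] at hl
    exact mul_le_mul_of_nonneg_left (dist_le_len pos p (eIdx_le_bIdx p hl.1 hl.2)) (hw _)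
  · rw [Finset.mem_Icc] at hl
    exact mul_le_mul_of_nonneg_left (dist_le_len pos p (bIdx_le_eIdx_succ p hl.2)) (hw _)

/-- The right-hand side of the first line of (2.48) (lengths of the portions). [cite: Balaban1984PropagatorsII, (2.48) p.232] -/
noncomputable def rhs248Len (zone : V → ℕ) (pos : V → X) (ℓ : ℕ → ℝ) (p : G.Walk x x') : ℝ :=
  (ℓ (zone x))⁻¹ * len pos p 0 (eIdx zone p 1)
    + ∑ l ∈ Finset.Icc 1 (m zone p), (ℓ (js zone p l))⁻¹ * len pos p (eIdx zone p l) (bIdx zone p l)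
    + ∑ l ∈ Finset.Icc 1 (m zone p),
        (ℓ (min (js zone p l) (js zone p (l + 1))))⁻¹ * len pos p (bIdx zone p l) (eIdx zone p (l + 1))

/-- The right-hand side of the second line of (2.48) (distances of the points y, y₁, y′₁, …, y_m, y′_m, y′).
[cite: Balaban1984PropagatorsII, (2.48) p.232] -/
noncomputable def rhs248Pts (zone : V → ℕ) (pos : V → X) (ℓ : ℕ → ℝ) (p : G.Walk x x') : ℝ :=
  (ℓ (zone x))⁻¹ * dist (pos x) (pos (p.getVert (eIdx zone p 1)))
    + ∑ l ∈ Finset.Icc 1 (m zone p),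
        (ℓ (js zone p l))⁻¹ * dist (pos (p.getVert (eIdx zone p l))) (pos (p.getVert (bIdx zone p l)))
    + ∑ l ∈ Finset.Icc 1 (m zone p), (ℓ (min (js zone p l) (js zone p (l + 1))))⁻¹
        * dist (pos (p.getVert (bIdx zone p l))) (pos (p.getVert (eIdx zone p (l + 1))))

/-- **(2.48) for every admissible contour**: |Γ|_bonds ≥ (2.48)₁ ≥ (2.48)₂. [cite: Balaban1984PropagatorsII, (2.48) p.232] -/
theorem ineq248_walk (hsep : Separates G zone) (hlen : BondScale G zone pos ℓ) (hmono : Monotone ℓ)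
    (hℓ : ∀ q, 0 < ℓ q) (p : G.Walk x x') :
    rhs248Pts zone pos ℓ p ≤ rhs248Len zone pos ℓ p ∧ rhs248Len zone pos ℓ p ≤ (p.length : ℝ) :=
  ⟨ineq248_line2 hℓ p, ineq248_line1 hsep hlen hmono hℓ p⟩

/-- **(2.48) AS PRINTED, for the distance (2.46)** (p. 231: *"Of course the infimum is attained at some contour
Γ_{y,y′}"*; p. 232: *"From this decomposition and the definition (2.46) we get d(y, y′) ≥ … ≥ … (2.48)"*): for two
lattice points joined by admissible contours there is a shortest admissible contour Γ_{y,y′}, d(y, y′) = |Γ_{y,y′}|_bonds,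
and its decomposition (2.47) gives both lines of (2.48). [cite: Balaban1984PropagatorsII, (2.46)–(2.48) pp.231–232] -/
theorem ineq248_dist (hsep : Separates G zone) (hlen : BondScale G zone pos ℓ) (hmono : Monotone ℓ)
    (hℓ : ∀ q, 0 < ℓ q) (hxx : G.Reachable x x') :
    ∃ p : G.Walk x x', p.length = G.dist x x' ∧
      rhs248Pts zone pos ℓ p ≤ rhs248Len zone pos ℓ p ∧ rhs248Len zone pos ℓ p ≤ (G.dist x x' : ℝ) := by
  obtain ⟨p, hp⟩ := hxx.exists_walk_length_eq_dist
  refine ⟨p, hp, ineq248_line2 hℓ p, ?_⟩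
  rw [← hp]
  exact ineq248_line1 hsep hlen hmono hℓ p

end Metric

/-! ## 5. The decomposition (2.47) assembled, and (2.47)–(2.48) over a contour system realising (2.46) -/

section Assembly

variable {V : Type*} {G : SimpleGraph V} {zone : V → ℕ} {x x' : V}

/-- **(2.47)** (p. 231 [9], verbatim: *"Continuing this way we obtain a sequence of points y, y₁, y′₁, y₂, y′₂, …, y_m,
y′_m, y′ on Γ_{y,y′}, and a sequence of indices j, j₁, j₂, …, j_m, j′ with the following properties: Γ_{y,y′} = Γ_{y,y₁}
∪ ⋃_{l=1}^m (Γ_{y_l,y′_l} ∪ Γ_{y′_l,y_{l+1}}), y_{m+1} = y′, (2.47) y_l, y′_l ∈ Σ_{j_l}, Γ_{y_l,y′_l} does not intersect any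
other surface Σ_j, j ≠ j_l, Γ_{y′_l,y_{l+1}} connects the surface Σ_{j_l} with the surface Σ_{j_{l+1}} and is contained in
B^{j_{l,l+1}}(Λ_{j_{l,l+1}}), where j_{l,l+1} = min{j_l, j_{l+1}}, |j_l − j_{l+1}| = 1."*; and *"The contour Γ_{y,y′}
starts at y and intersects either the surface Σ_j, or the surface Σ_{j+1}, the first time at a point y₁"*), KERNEL-DERIVED
for EVERY admissible contour Γ = (v₀, …, v_n) from y = v₀ to y′ = v_n in a zoned graph of admissible bonds in which
Σ_j separates: with the indices 0 = b₀ ≤ e₁ ≤ b₁ < e₂ ≤ b₂ < … < e_m ≤ b_m ≤ e_{m+1} = n of §2 (y_l = v_{e_l},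
y′_l = v_{b_l}; the portions are the index intervals, so (2.47) as a union holds by construction) —
(i) y_l, y′_l ∈ Σ_{j_l}; (ii) no point of Γ_{y_l,y′_l} lies on a surface Σ_j with j ≠ j_l; (iii) every bond of
Γ_{y′_l,y_{l+1}} (l = 0, …, m; y′₀ := y) is a Λ_{min{j_l,j_{l+1}}}-bond and its interior points lie on no surface;
(iv) |j_l − j_{l+1}| = 1 (1 ≤ l < m); (v) j₁ ∈ {j, j + 1} and j_m ∈ {j′, j′ + 1}, j₀ = j = zone y, j_{m+1} = j′ = zone y′;
(vi) no point of Γ_{y,y₁} before y₁ lies on a surface. [cite: Balaban1984PropagatorsII, (2.47) p.231] -/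
theorem decomp247 (hsep : Separates G zone) (p : G.Walk x x') :
    bIdx zone p 0 = 0 ∧ eIdx zone p (m zone p + 1) = p.length ∧
    (∀ l, 1 ≤ l → l ≤ m zone p → eIdx zone p l ≤ bIdx zone p l) ∧
    (∀ l, l ≤ m zone p → bIdx zone p l ≤ eIdx zone p (l + 1)) ∧
    (∀ l, 1 ≤ l → l ≤ m zone p →
      OnSurf G zone (js zone p l) (p.getVert (eIdx zone p l)) ∧ OnSurf G zone (js zone p l) (p.getVert (bIdx zone p l))) ∧
    (∀ l, 1 ≤ l → l ≤ m zone p → ∀ i, eIdx zone p l ≤ i → i ≤ bIdx zone p l →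
      ∀ j, j ≠ js zone p l → ¬ OnSurf G zone j (p.getVert i)) ∧
    (∀ l, l ≤ m zone p → ∀ i, bIdx zone p l ≤ i → i < eIdx zone p (l + 1) →
      min (zone (p.getVert i)) (zone (p.getVert (i + 1))) = min (js zone p l) (js zone p (l + 1))) ∧
    (∀ l, l ≤ m zone p → ∀ i, bIdx zone p l < i → i < eIdx zone p (l + 1) → ¬ OnSomeSurf G zone (p.getVert i)) ∧
    (∀ l, 1 ≤ l → l + 1 ≤ m zone p →
      js zone p (l + 1) + 1 = js zone p l ∨ js zone p l + 1 = js zone p (l + 1)) ∧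
    (js zone p 0 = zone x ∧ js zone p (m zone p + 1) = zone x' ∧
      zone x ≤ js zone p 1 ∧ js zone p 1 ≤ zone x + 1 ∧
      zone x' ≤ js zone p (m zone p) ∧ js zone p (m zone p) ≤ zone x' + 1) ∧
    (∀ i, i < eIdx zone p 1 → ¬ OnSomeSurf G zone (p.getVert i)) := by
  refine ⟨bIdx_zero p, eIdx_m_succ p, fun l hl1 hl => eIdx_le_bIdx p hl1 hl, fun l hl => bIdx_le_eIdx_succ p hl,
    fun l hl1 hl => ⟨?_, onSurf_bIdx p hl1 hl⟩, fun l hl1 hl i hi1 hi2 j hj => ?_, fun l hl => (X_facts hsep p hl).1,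
    fun l hl i hi1 hi2 => ?_, fun l hl1 hl => js_step hsep p hl1 hl,
    ⟨js_zero p, js_m_succ p, (js_one_bounds hsep p).1, (js_one_bounds hsep p).2, (js_m_bounds hsep p).1,
      (js_m_bounds hsep p).2⟩, fun i hi => ?_⟩
  · rw [getVert_eIdx]; exact onSurf_aIdx p hl1 hl
  · rw [eIdx_of_le p hl1 hl] at hi1
    exact not_onSurf_S p hl1 hl hi1 hi2 hj
  · exact not_surfAt_X p hl hi1 (Nat.lt_of_lt_of_le hi2 (min_le_left _ _))
      (Nat.le_trans hi2.le (eIdx_le_length p (l + 1)))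
  · exact not_surfAt_of_lt_aIdx_one p (Nat.lt_of_lt_of_le hi (min_le_left _ _))

variable {g : B6.Geometry} {X : Type*} [PseudoMetricSpace X]

/-- ℓ j = L^jη is monotone and positive for L ≥ 1, η > 0. [cite: Balaban1984PropagatorsII, (2.1)–(2.2) p.224] -/
theorem scaleLen_mono_pos (hL : 1 ≤ g.L) (hη : 0 < g.eta) :
    Monotone (fun j => g.L ^ j * g.eta) ∧ ∀ q, 0 < g.L ^ q * g.eta :=
  ⟨fun _ _ hab => mul_le_mul_of_nonneg_right (pow_le_pow_right₀ hL hab) hη.le,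
    fun q => mul_pos (pow_pos (by linarith) q) hη⟩

/-- **(2.47)–(2.48) over a contour system realising (2.46)** (`B6Geometry.ContourSystem`/`Realizes`, the typed
generality of d(y, y′) in the tree): for a geometry `g` whose distance IS (2.46), admissible contours existing
(`Connected`), Σ_j separating (`Separates`), drawn in a (pseudo)metric space with Λ_j-bonds of length ≤ L^jη
(`B6LevelGapMetric.BondScale22`), L ≥ 1, η > 0: for all y, y′ ∈ 𝔅 there is a shortest admissible contour Γ_{y,y′},
d(y, y′) = |Γ_{y,y′}|_bonds, its decomposition (2.47) holds (`decomp247`) and d(y, y′) ≥ (2.48)₁ ≥ (2.48)₂ with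
j = scale y. [cite: Balaban1984PropagatorsII, (2.46)–(2.48) pp.231–232] -/
theorem ineq248_of_realizes {C : ContourSystem g} (h : Realizes g C) (hconn : C.bond.Connected)
    (hsep : Separates C.bond C.zone) {pos : C.Pt → X} (hlen : BondScale22 C pos) (hL : 1 ≤ g.L) (hη : 0 < g.eta)
    (y y' : g.Site) :
    ∃ p : C.bond.Walk (C.ι y) (C.ι y'), (p.length : ℝ) = g.dist y y' ∧ C.zone (C.ι y) = g.scale y ∧
      rhs248Pts C.zone pos (fun j => g.L ^ j * g.eta) p ≤ rhs248Len C.zone pos (fun j => g.L ^ j * g.eta) p ∧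
      rhs248Len C.zone pos (fun j => g.L ^ j * g.eta) p ≤ g.dist y y' := by
  obtain ⟨hmono, hpos⟩ := scaleLen_mono_pos hL hη
  obtain ⟨p, hp, h2, h1⟩ := ineq248_dist (zone := C.zone) hsep hlen hmono hpos (hconn (C.ι y) (C.ι y'))
  have hd : g.dist y y' = (C.bond.dist (C.ι y) (C.ι y') : ℝ) := h y y'
  refine ⟨p, ?_, C.zone_ι y, h2, ?_⟩
  · rw [hd, hp]
  · rw [hd]; exact h1

end Assembly

/-! ## 6. Model instance: the (k+1)-level tower `B6LevelTower.twGeo` -/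

section Tower

open B6LevelTower

variable (d : ℕ) [NeZero d] (k a mm L : ℕ) (η R : ℝ)

/-- **(2.47)–(2.48) on the coordinatised (k+1)-level tower** of `B6LevelTower` (sites `TW d k a`, levels = zones,
admissible bonds = `graph L`, drawing `tposR L η` in ℝ^d with each Λ_j-bond of length exactly L^jη): the tower realises
(2.46) (`twGeo_realizes`), its contours exist (`twCS_connected`), Σ_j separates (`twCS_separates`) and (len) holds
(`twCS_bondScale22`), so §5 applies BY NAME: for all sites y, y′ a shortest admissible contour exists, d(y, y′) = its
bond count, (2.47) holds for it and d(y, y′) ≥ (2.48)₁ ≥ (2.48)₂ (L ≥ 1, η > 0). [cite: Balaban1984PropagatorsII, (2.46)–(2.48) pp.231–232] -/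
theorem ineq248_tower (hL : 1 ≤ L) (hη : 0 < η) (y y' : TW d k a) :
    ∃ p : (twCS d k a mm L η R).bond.Walk y y',
      (p.length : ℝ) = (twGeo d k a mm L η R).dist y y' ∧
      rhs248Pts (twCS d k a mm L η R).zone (tposR L η) (fun j => (L : ℝ) ^ j * η) p
        ≤ rhs248Len (twCS d k a mm L η R).zone (tposR L η) (fun j => (L : ℝ) ^ j * η) p ∧
      rhs248Len (twCS d k a mm L η R).zone (tposR L η) (fun j => (L : ℝ) ^ j * η) p
        ≤ (twGeo d k a mm L η R).dist y y' := by
  have hL' : (1 : ℝ) ≤ (twGeo d k a mm L η R).L := by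
    show (1 : ℝ) ≤ (L : ℝ); exact_mod_cast hL
  obtain ⟨p, hp, -, h2, h1⟩ := ineq248_of_realizes (twGeo_realizes (d := d) (k := k) (a := a) (m := mm) (L := L)
    (η := η) (R := R)) (twCS_connected d k a mm L η R) (twCS_separates d k a mm L η R)
    (twCS_bondScale22 d k a mm L η R hη.le) hL' hη y y'
  exact ⟨p, hp, h2, h1⟩

/- The decomposition (2.47) of every admissible contour of the tower is `decomp247 (twCS_separates d k a m L η R) p`. -/
example (y y' : TW d k a) (p : (twCS d k a mm L η R).bond.Walk y y') :=
  decomp247 (twCS_separates d k a mm L η R) p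

end Tower

end Literature.MathematicalPhysics.QuantumFieldTheory.Balaban1983to89.B6Decomp247Surfaces
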